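import Literature.Analysis.FunctionSpaces.PolchinskiLogSobolevC1
import HarnessLib

/-!
# From the entropy inequality for smooth positive `F` to the log-Sobolev inequality for `f²`,
# `f ∈ C_c^∞` and `f ∈ C¹_c` — abstract bridges (Bauerschmidt–Bodineau–Dagallier, Theorem 3, (e:LSI))

Topic `Literature/Analysis/FunctionSpaces`; companion of `PolchinskiLogSobolevGradient.lean` and
`PolchinskiLogSobolevC1.lean`.

Those two files pass from the printed form of [BBD] Theorem 3 (`Ent_{ν₀}(F) ≤ (2/γ)E_{ν₀}[(∇√F)²_{Ċ₀}]`
for smooth `F` with values in a compact interval `I ⊂ (0,∞)`, p0016 L43) to the log-Sobolev form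
`Ent_{ν₀}(f²) ≤ 2(∫₀^∞e^{−2λ_t}dt)·E_{ν₀}[⟨∇f, Ċ₀∇f⟩]` for `f ∈ C_c^∞` and then `f ∈ C¹_c`, for the
hypothesis class `V₀ ∈ C_b⁴`.  The passages use nothing about the measure except that it is a probability
measure.  This file records them ABSTRACTLY — for an arbitrary probability measure `ν` on `ℝ^N`, a
positive semidefinite matrix `C₀` and a constant `I ≥ 0` — so that every version of Theorem 3 proved in
its `F log F` form (e.g. for the smoothed class, `PolchinskiLogSobolevSmoothed.lean`) yields the `C¹_c`
log-Sobolev form at once: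

* **`logSobolev_sq_of_entropy_le`** — if `Ent_ν(F) ≤ 2I·∫ Σ C₀^{kl}∂_kF∂_lF/(4F) dν` for every
  `F ∈ C^∞` with bounded derivatives of orders `≤ 8` and `0 < a ≤ F ≤ b`, then
  `Ent_ν(f²) ≤ 2I·∫⟨∇f, C₀∇f⟩ dν` for every `f ∈ C_c^∞` (`F = f² + ε`, `ε ↓ 0`);
* **`logSobolev_sq_of_contDiff_one_of_smooth`** — if the latter holds for every `f ∈ C_c^∞` then it holds
  for every `f ∈ C¹_c` (mollification `ρ_n ⋆ f`, dominated convergence).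

Pure real analysis; no new definitions, no named facts; nothing here concerns Yang–Mills.

## References

* [BauerschmidtBodineauDagallier2023] R. Bauerschmidt, T. Bodineau, B. Dagallier, Probab. Surveys 21
  (2024) 200–290, arXiv:2307.07619 — Theorem 3 p0015 L62–90 ((e:LSI)), p0016 L40–45. READ (held text).
-/

noncomputable section

set_option maxSynthPendingDepth 3

open MeasureTheory ProbabilityTheory Filter Topology Set
open scoped RealInnerProductSpace Matrix MatrixOrder ContDiff Gradient Convolution

namespace Literature.Analysis.FunctionSpaces

namespace Polchinski

variable {N : ℕ}

section Helpers

/-- `⟪v, C v⟫ = Σ_{kl} C_{kl} v_k v_l` on `EuclideanSpace`. [folklore] -/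
private theorem inner_toEuclideanLin_self'' (C : Matrix (Fin N) (Fin N) ℝ)
    (v : EuclideanSpace ℝ (Fin N)) :
    ⟪v, Matrix.toEuclideanLin C v⟫ = ∑ k, ∑ l, C k l * (v k * v l) := by
  rw [EuclideanSpace.inner_eq_star_dotProduct, star_trivial]
  show (C *ᵥ WithLp.ofLp v) ⬝ᵥ WithLp.ofLp v = _
  simp only [dotProduct, Matrix.mulVec, Finset.sum_mul]
  exact Finset.sum_congr rfl fun k _ => Finset.sum_congr rfl fun l _ => by ring

/-- Coordinates of the gradient: `(∇f)_k = ∂_k f`. [folklore] -/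
private theorem gradient_apply_single'' (f : EuclideanSpace ℝ (Fin N) → ℝ)
    (φ : EuclideanSpace ℝ (Fin N)) (k : Fin N) :
    (gradient f φ) k = fderiv ℝ f φ (EuclideanSpace.single k 1) := by
  have h := EuclideanSpace.inner_single_right k (1 : ℝ) (gradient f φ)
  simp only [one_mul, RCLike.conj_to_real] at h
  rw [← h, inner_gradient_left]

/-- A smooth compactly supported function has bounded derivatives of orders `≤ 8`. [folklore] -/
private theorem exists_bound_iteratedFDeriv₈ {g : EuclideanSpace ℝ (Fin N) → ℝ} (hg : ContDiff ℝ ∞ g)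
    (hgc : HasCompactSupport g) : ∃ B, ∀ n ≤ 8, ∀ x, ‖iteratedFDeriv ℝ n g x‖ ≤ B := by
  have hb : ∀ n : ℕ, ∃ B, ∀ x, ‖iteratedFDeriv ℝ n g x‖ ≤ B := fun n =>
    (contDiff_infty.1 hg n).continuous_iteratedFDeriv'.bounded_above_of_compact_support
      (hgc.iteratedFDeriv n)
  choose B hB using hb
  refine ⟨∑ n ∈ Finset.range 9, |B n|, fun n hn x => (hB n x).trans ((le_abs_self _).trans
    (Finset.single_le_sum (f := fun n => |B n|) (fun _ _ => abs_nonneg _)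
      (Finset.mem_range.2 (by omega))))⟩

end Helpers

section Bridges

variable (ν : Measure (EuclideanSpace ℝ (Fin N))) [IsProbabilityMeasure ν]
  (C0 : Matrix (Fin N) (Fin N) ℝ) (I : ℝ)

set_option maxHeartbeats 800000 in
/-- **From `Ent(F)` for smooth positive `F` to `Ent(f²)` for `f ∈ C_c^∞`** (the passage from the printed
form of [BBD] Theorem 3 to its log-Sobolev form (e:LSI), abstractly): let `ν` be a probability measure on
`ℝ^N`, `C₀ ≥ 0` a positive semidefinite matrix and `I ≥ 0`.  If
`∫ F log F dν − (∫F dν) log(∫F dν) ≤ 2I·∫ Σ_{kl} C₀^{kl} ∂_kF ∂_lF/(4F) dν` for every `F ∈ C^∞(ℝ^N)` with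
bounded derivatives of orders `≤ 8` and `0 < a ≤ F ≤ b`, then for every smooth compactly supported `f`,
`∫ f² log f² dν − (∫f² dν) log(∫f² dν) ≤ 2I·∫⟨∇f, C₀∇f⟩ dν` (apply the hypothesis to `F = f² + ε`, use
`(∇(f²+ε))²_{C₀}/(4(f²+ε)) ≤ (∇f)²_{C₀}` and let `ε ↓ 0`). [cite: BauerschmidtBodineauDagallier2023, Theorem 3] -/
theorem logSobolev_sq_of_entropy_le (hC0 : C0.PosSemidef) (hI : 0 ≤ I)
    (hF : ∀ (F : EuclideanSpace ℝ (Fin N) → ℝ) (BF a b : ℝ), ContDiff ℝ ∞ F →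
      (∀ n ≤ 8, ∀ x, ‖iteratedFDeriv ℝ n F x‖ ≤ BF) → 0 < a → (∀ x, a ≤ F x ∧ F x ≤ b) →
      ∫ φ, F φ * Real.log (F φ) ∂ν - (∫ φ, F φ ∂ν) * Real.log (∫ φ, F φ ∂ν) ≤
        2 * I * ∫ φ, (1 / 4) * ((∑ k, ∑ l, C0 k l *
          (fderiv ℝ F φ (EuclideanSpace.single k 1) * fderiv ℝ F φ (EuclideanSpace.single l 1))) *
          (F φ)⁻¹) ∂ν)
    (f : EuclideanSpace ℝ (Fin N) → ℝ) (hf : ContDiff ℝ ∞ f) (hfc : HasCompactSupport f) :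
    ∫ φ, f φ ^ 2 * Real.log (f φ ^ 2) ∂ν - (∫ φ, f φ ^ 2 ∂ν) * Real.log (∫ φ, f φ ^ 2 ∂ν) ≤
      2 * I * ∫ φ, ⟪gradient f φ, Matrix.toEuclideanLin C0 (gradient f φ)⟫ ∂ν := by
  classical
  ---------------------------------------------------------------- bounds on `f` and its derivatives
  obtain ⟨Bf, hBf⟩ := exists_bound_iteratedFDeriv₈ hf hfc
  have hBf4 : ∀ n ≤ 4, ∀ x, ‖iteratedFDeriv ℝ n f x‖ ≤ Bf := fun n hn => hBf n (by omega)
  have hfabs : ∀ x, |f x| ≤ Bf := Cb4.abs_le hBf4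
  have hBf0 : 0 ≤ Bf := (abs_nonneg _).trans (hfabs 0)
  have hf2le : ∀ x, f x ^ 2 ≤ Bf ^ 2 := fun x => by
    rw [← sq_abs]; exact pow_le_pow_left₀ (abs_nonneg _) (hfabs x) 2
  have hf4 : ContDiff ℝ 4 f := contDiff_infty.1 hf 4
  have hfd : ∀ x, HasFDerivAt f (fderiv ℝ f x) x := Cb4.hasFDerivAt hf4
  have hdf : ∀ k x, |fderiv ℝ f x (EuclideanSpace.single k 1)| ≤ Bf := fun k x => by
    have h := Cb4.abs_partial_le hBf4 (EuclideanSpace.single k 1) x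
    rwa [Cb4.norm_single_one, mul_one] at h
  have hdfc : ∀ k, Continuous fun x => fderiv ℝ f x (EuclideanSpace.single k 1) := fun k =>
    (ContinuousLinearMap.apply ℝ ℝ (EuclideanSpace.single k 1)).continuous.comp
      (atom_continuous hf4 hBf4).2.1
  -- the square has bounded derivatives
  have hf2 : ContDiff ℝ ∞ (fun x => f x ^ 2) := hf.pow 2
  have hf2c : HasCompactSupport (fun x => f x ^ 2) := by
    have : (fun x => f x ^ 2) = f * f := funext fun x => by simp [pow_two]
    rw [this]
    exact hfc.mul_right
  obtain ⟨B2, hB2⟩ := exists_bound_iteratedFDeriv₈ hf2 hf2c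
  have hB20 : 0 ≤ B2 := le_trans (norm_nonneg _) (hB2 0 (by norm_num) 0)
  -- the right-hand side integrand
  have hQ : ∀ φ, ⟪gradient f φ, Matrix.toEuclideanLin C0 (gradient f φ)⟫ =
      ∑ k, ∑ l, C0 k l * (fderiv ℝ f φ (EuclideanSpace.single k 1) *
        fderiv ℝ f φ (EuclideanSpace.single l 1)) := fun φ => by
    rw [inner_toEuclideanLin_self'']
    simp only [gradient_apply_single'']
  have hQnn : ∀ φ, 0 ≤ ∑ k, ∑ l, C0 k l * (fderiv ℝ f φ (EuclideanSpace.single k 1) *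
      fderiv ℝ f φ (EuclideanSpace.single l 1)) :=
    fun φ => sum_sum_mul_mul_self_nonneg hC0 _
  have hQc : Continuous fun φ => ∑ k, ∑ l, C0 k l * (fderiv ℝ f φ (EuclideanSpace.single k 1) *
      fderiv ℝ f φ (EuclideanSpace.single l 1)) :=
    continuous_finsetSum _ fun k _ => continuous_finsetSum _ fun l _ =>
      continuous_const.mul ((hdfc k).mul (hdfc l))
  have hQb : ∀ φ, |∑ k, ∑ l, C0 k l * (fderiv ℝ f φ (EuclideanSpace.single k 1) *
      fderiv ℝ f φ (EuclideanSpace.single l 1))| ≤ ∑ k : Fin N, ∑ l : Fin N, |C0 k l| * (Bf * Bf) :=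
    fun φ => (Finset.abs_sum_le_sum_abs _ _).trans (Finset.sum_le_sum fun k _ =>
      (Finset.abs_sum_le_sum_abs _ _).trans (Finset.sum_le_sum fun l _ => by
        rw [abs_mul, abs_mul]
        exact mul_le_mul_of_nonneg_left (mul_le_mul (hdf k φ) (hdf l φ) (abs_nonneg _) hBf0)
          (abs_nonneg _)))
  have hQi : Integrable (fun φ => ∑ k, ∑ l, C0 k l * (fderiv ℝ f φ (EuclideanSpace.single k 1) *
      fderiv ℝ f φ (EuclideanSpace.single l 1))) ν :=
    Integrable.of_bound hQc.aestronglyMeasurable _ (Eventually.of_forall fun φ => by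
      rw [Real.norm_eq_abs]; exact hQb φ)
  ---------------------------------------------------------------- the hypothesis for `F = f² + ε`
  have hstep : ∀ ε : ℝ, 0 < ε →
      ∫ φ, (f φ ^ 2 + ε) * Real.log (f φ ^ 2 + ε) ∂ν -
          (∫ φ, (f φ ^ 2 + ε) ∂ν) * Real.log (∫ φ, (f φ ^ 2 + ε) ∂ν) ≤
        2 * I * ∫ φ, ⟪gradient f φ, Matrix.toEuclideanLin C0 (gradient f φ)⟫ ∂ν := by
    intro ε hε
    have hFs : ContDiff ℝ ∞ (fun x => f x ^ 2 + ε) := hf2.add contDiff_const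
    have hFB : ∀ n ≤ 8, ∀ x, ‖iteratedFDeriv ℝ n (fun x => f x ^ 2 + ε) x‖ ≤ B2 + ε := by
      intro n hn x
      rcases Nat.eq_zero_or_pos n with h0 | hpos
      · subst h0
        rw [norm_iteratedFDeriv_zero, Real.norm_eq_abs]
        have h := hB2 0 (by norm_num) x
        rw [norm_iteratedFDeriv_zero, Real.norm_eq_abs] at h
        calc |f x ^ 2 + ε| ≤ |f x ^ 2| + |ε| := abs_add_le _ _
          _ ≤ B2 + ε := by rw [abs_of_pos hε]; linarith
      · have he : (fun x => f x ^ 2 + ε) = (fun x => f x ^ 2) + fun _ => ε := rfl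
        rw [he, iteratedFDeriv_add_apply (contDiff_infty.1 hf2 n).contDiffAt contDiffAt_const,
          iteratedFDeriv_const_of_ne (Nat.pos_iff_ne_zero.1 hpos), Pi.zero_apply, add_zero]
        exact (hB2 n hn x).trans (le_add_of_nonneg_right hε.le)
    have hab : ∀ x, ε ≤ f x ^ 2 + ε ∧ f x ^ 2 + ε ≤ Bf ^ 2 + ε := fun x =>
      ⟨le_add_of_nonneg_left (sq_nonneg _), by linarith [hf2le x]⟩
    have hmain := hF (fun x => f x ^ 2 + ε) (B2 + ε) ε (Bf ^ 2 + ε) hFs hFB hε hab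
    refine hmain.trans (mul_le_mul_of_nonneg_left ?_ (by positivity))
    -- compare the integrands
    have hder : ∀ φ k, fderiv ℝ (fun x => f x ^ 2 + ε) φ (EuclideanSpace.single k 1) =
        2 * f φ * fderiv ℝ f φ (EuclideanSpace.single k 1) := fun φ k => by
      rw [(((hfd φ).pow 2).add_const ε).fderiv]
      simp only [_root_.smul_apply, smul_eq_mul, nsmul_eq_mul, Nat.cast_ofNat,
        show (2 : ℕ) - 1 = 1 from rfl, pow_one]
    refine integral_mono_of_nonneg (Eventually.of_forall fun φ => ?_)
      (by simp only [hQ]; exact hQi) (Eventually.of_forall fun φ => ?_)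
    · exact mul_nonneg (by norm_num) (mul_nonneg (sum_sum_mul_mul_self_nonneg hC0 _)
        (inv_nonneg.2 (hε.le.trans (hab φ).1)))
    · simp only [hder, hQ]
      have hpos : 0 < f φ ^ 2 + ε := hε.trans_le (hab φ).1
      have hS := hQnn φ
      have heq : (1 / 4) * ((∑ k, ∑ l, C0 k l * (2 * f φ * fderiv ℝ f φ (EuclideanSpace.single k 1) *
          (2 * f φ * fderiv ℝ f φ (EuclideanSpace.single l 1)))) * (f φ ^ 2 + ε)⁻¹) =
          (f φ ^ 2 / (f φ ^ 2 + ε)) * ∑ k, ∑ l, C0 k l *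
            (fderiv ℝ f φ (EuclideanSpace.single k 1) * fderiv ℝ f φ (EuclideanSpace.single l 1)) := by
        simp only [Finset.mul_sum, Finset.sum_mul]
        refine Finset.sum_congr rfl fun k _ => Finset.sum_congr rfl fun l _ => ?_
        ring
      rw [heq]
      have hratio : f φ ^ 2 / (f φ ^ 2 + ε) ≤ 1 := by
        rw [div_le_one hpos]; linarith
      calc f φ ^ 2 / (f φ ^ 2 + ε) * _ ≤ 1 * _ := mul_le_mul_of_nonneg_right hratio hS
        _ = _ := one_mul _
  ---------------------------------------------------------------- `ε ↓ 0`
  obtain ⟨M, hM⟩ := isCompact_Icc.exists_bound_of_continuousOn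
    (Real.continuous_mul_log.continuousOn (s := Icc (0 : ℝ) (Bf ^ 2 + 1)))
  have hA : Tendsto (fun ε : ℝ => ∫ φ, (f φ ^ 2 + ε) * Real.log (f φ ^ 2 + ε) ∂ν) (𝓝[>] 0)
      (𝓝 (∫ φ, f φ ^ 2 * Real.log (f φ ^ 2) ∂ν)) := by
    refine tendsto_integral_filter_of_dominated_convergence (fun _ => M) ?_ ?_ (integrable_const M) ?_
    · exact Eventually.of_forall fun ε =>
        (Real.continuous_mul_log.comp ((hf.continuous.pow 2).add continuous_const)).aestronglyMeasurable
    · filter_upwards [Ioo_mem_nhdsGT one_pos] with ε hε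
      exact Eventually.of_forall fun φ => hM _ ⟨by nlinarith [sq_nonneg (f φ), hε.1],
        by linarith [hf2le φ, hε.2]⟩
    · exact Eventually.of_forall fun φ => by
        have hc : Tendsto (fun ε : ℝ => f φ ^ 2 + ε) (𝓝[>] 0) (𝓝 (f φ ^ 2)) := by
          have h : Tendsto (fun ε : ℝ => f φ ^ 2 + ε) (𝓝 0) (𝓝 (f φ ^ 2 + 0)) :=
            tendsto_const_nhds.add tendsto_id
          rw [add_zero] at h
          exact h.mono_left nhdsWithin_le_nhds
        exact (Real.continuous_mul_log.tendsto _).comp hc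
  have hf2i : Integrable (fun φ => f φ ^ 2) ν :=
    Integrable.of_bound ((hf.continuous.pow 2).aestronglyMeasurable) (Bf ^ 2)
      (Eventually.of_forall fun φ => by
        rw [Real.norm_eq_abs, abs_of_nonneg (sq_nonneg _)]; exact hf2le φ)
  have hmean : ∀ ε : ℝ, ∫ φ, (f φ ^ 2 + ε) ∂ν = (∫ φ, f φ ^ 2 ∂ν) + ε := fun ε => by
    rw [integral_add hf2i (integrable_const ε), integral_const, probReal_univ, one_smul]
  have hB : Tendsto (fun ε : ℝ => (∫ φ, (f φ ^ 2 + ε) ∂ν) * Real.log (∫ φ, (f φ ^ 2 + ε) ∂ν))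
      (𝓝[>] 0) (𝓝 ((∫ φ, f φ ^ 2 ∂ν) * Real.log (∫ φ, f φ ^ 2 ∂ν))) := by
    simp only [hmean]
    have hc : Tendsto (fun ε : ℝ => (∫ φ, f φ ^ 2 ∂ν) + ε) (𝓝[>] 0) (𝓝 (∫ φ, f φ ^ 2 ∂ν)) := by
      have h : Tendsto (fun ε : ℝ => (∫ φ, f φ ^ 2 ∂ν) + ε) (𝓝 0) (𝓝 ((∫ φ, f φ ^ 2 ∂ν) + 0)) :=
        tendsto_const_nhds.add tendsto_id
      rw [add_zero] at h
      exact h.mono_left nhdsWithin_le_nhds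
    exact (Real.continuous_mul_log.tendsto _).comp hc
  refine le_of_tendsto (hA.sub hB) ?_
  filter_upwards [self_mem_nhdsWithin] with ε hε
  exact hstep ε hε

set_option maxHeartbeats 800000 in
/-- **From `f ∈ C_c^∞` to `f ∈ C¹_c`** (the conventional test class of (e:LSI), abstractly): let `ν` be a
probability measure on `ℝ^N`, `C₀` a matrix and `I` a real.  If
`∫ g² log g² dν − (∫g² dν) log(∫g² dν) ≤ 2I·∫⟨∇g, C₀∇g⟩ dν` for every smooth compactly supported `g`,
then the same holds for every `f ∈ C¹(ℝ^N)` with compact support (mollification `ρ_n ⋆ f ∈ C_c^∞`,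
`ρ_n ⋆ f → f` and `∇(ρ_n ⋆ f) → ∇f` boundedly, dominated convergence).
[cite: BauerschmidtBodineauDagallier2023, Theorem 3] -/
theorem logSobolev_sq_of_contDiff_one_of_smooth
    (hg : ∀ g : EuclideanSpace ℝ (Fin N) → ℝ, ContDiff ℝ ∞ g → HasCompactSupport g →
      ∫ φ, g φ ^ 2 * Real.log (g φ ^ 2) ∂ν - (∫ φ, g φ ^ 2 ∂ν) * Real.log (∫ φ, g φ ^ 2 ∂ν) ≤
        2 * I * ∫ φ, ⟪gradient g φ, Matrix.toEuclideanLin C0 (gradient g φ)⟫ ∂ν)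
    (f : EuclideanSpace ℝ (Fin N) → ℝ) (hf : ContDiff ℝ 1 f) (hfc : HasCompactSupport f) :
    ∫ φ, f φ ^ 2 * Real.log (f φ ^ 2) ∂ν - (∫ φ, f φ ^ 2 ∂ν) * Real.log (∫ φ, f φ ^ 2 ∂ν) ≤
      2 * I * ∫ φ, ⟪gradient f φ, Matrix.toEuclideanLin C0 (gradient f φ)⟫ ∂ν := by
  classical
  ---------------------------------------------------------------- bounds on `f`, `∇f`
  have hfcont : Continuous f := hf.continuous
  have hdfcont : Continuous (fderiv ℝ f) := hf.continuous_fderiv one_ne_zero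
  have hdfc : HasCompactSupport (fderiv ℝ f) := hfc.fderiv (𝕜 := ℝ)
  obtain ⟨Bf, hBf⟩ : ∃ B, ∀ x, ‖f x‖ ≤ B := hfcont.bounded_above_of_compact_support hfc
  obtain ⟨Bd, hBd⟩ : ∃ B, ∀ x, ‖fderiv ℝ f x‖ ≤ B := hdfcont.bounded_above_of_compact_support hdfc
  have hBf0 : 0 ≤ Bf := (norm_nonneg _).trans (hBf 0)
  have hBd0 : 0 ≤ Bd := (norm_nonneg _).trans (hBd 0)
  have hdfk : ∀ x (k : Fin N), |fderiv ℝ f x (EuclideanSpace.single k 1)| ≤ Bd := fun x k => by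
    have h := (fderiv ℝ f x).le_opNorm (EuclideanSpace.single k 1)
    rw [Cb4.norm_single_one, mul_one] at h
    exact (Real.norm_eq_abs _ ▸ h).trans (hBd x)
  ---------------------------------------------------------------- the mollifiers
  let ρ : ℕ → ContDiffBump (0 : EuclideanSpace ℝ (Fin N)) := fun n =>
    ⟨1 / ((n : ℝ) + 2), 1 / ((n : ℝ) + 1), by positivity,
      one_div_lt_one_div_of_lt (by positivity) (by linarith)⟩
  have hρ : Tendsto (fun n => (ρ n).rOut) atTop (𝓝 0) := by
    show Tendsto (fun n : ℕ => 1 / ((n : ℝ) + 1)) atTop (𝓝 0)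
    exact tendsto_one_div_add_atTop_nhds_zero_nat
  have hρli : ∀ n, LocallyIntegrable ((ρ n).normed volume) volume := fun n =>
    (ρ n).continuous_normed.locallyIntegrable
  let g : ℕ → EuclideanSpace ℝ (Fin N) → ℝ := fun n =>
    (ρ n).normed volume ⋆[ContinuousLinearMap.lsmul ℝ ℝ, volume] f
  have hgs : ∀ n, ContDiff ℝ ∞ (g n) := fun n =>
    (ρ n).hasCompactSupport_normed.contDiff_convolution_left _ (ρ n).contDiff_normed
      hfcont.locallyIntegrable
  have hgc : ∀ n, HasCompactSupport (g n) := fun n =>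
    (ρ n).hasCompactSupport_normed.convolution _ hfc
  -- the hypothesis for each mollification
  have hstep : ∀ n,
      ∫ φ, g n φ ^ 2 * Real.log (g n φ ^ 2) ∂ν - (∫ φ, g n φ ^ 2 ∂ν) * Real.log (∫ φ, g n φ ^ 2 ∂ν) ≤
        2 * I * ∫ φ, ⟪gradient (g n) φ, Matrix.toEuclideanLin C0 (gradient (g n) φ)⟫ ∂ν :=
    fun n => hg (g n) (hgs n) (hgc n)
  ---------------------------------------------------------------- pointwise convergence
  have hg_tend : ∀ x, Tendsto (fun n => g n x) atTop (𝓝 (f x)) := fun x =>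
    ContDiffBump.convolution_tendsto_right_of_continuous hρ hfcont x
  have hdg : ∀ n x, HasFDerivAt (g n)
      (((ρ n).normed volume ⋆[(ContinuousLinearMap.lsmul ℝ ℝ).precompR (EuclideanSpace ℝ (Fin N)),
        volume] fderiv ℝ f) x) x :=
    fun n x => hfc.hasFDerivAt_convolution_right _ (hρli n) hf x
  have hdg_apply : ∀ n x (v : EuclideanSpace ℝ (Fin N)), fderiv ℝ (g n) x v =
      ((ρ n).normed volume ⋆[ContinuousLinearMap.lsmul ℝ ℝ, volume] fun a => fderiv ℝ f a v) x := by
    intro n x v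
    rw [(hdg n x).fderiv, convolution_precompR_apply _ (hρli n) hdfc hdfcont]
  have hdfv : ∀ v : EuclideanSpace ℝ (Fin N), Continuous fun a => fderiv ℝ f a v := fun v =>
    (ContinuousLinearMap.apply ℝ ℝ v).continuous.comp hdfcont
  have hdg_tend : ∀ x (v : EuclideanSpace ℝ (Fin N)),
      Tendsto (fun n => fderiv ℝ (g n) x v) atTop (𝓝 (fderiv ℝ f x v)) := by
    intro x v
    simp only [hdg_apply]
    exact ContDiffBump.convolution_tendsto_right_of_continuous hρ (hdfv v) x
  ---------------------------------------------------------------- uniform bounds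
  have hg_bd : ∀ n x, |g n x| ≤ 3 * Bf := by
    intro n x
    have h : dist (g n x) (f x) ≤ 2 * Bf := by
      refine (ρ n).dist_normed_convolution_le hfcont.aestronglyMeasurable fun y _ => ?_
      rw [dist_eq_norm]
      exact (norm_sub_le _ _).trans (by linarith [hBf y, hBf x])
    rw [Real.dist_eq] at h
    have hx : |f x| ≤ Bf := Real.norm_eq_abs _ ▸ hBf x
    calc |g n x| = |(g n x - f x) + f x| := by ring_nf
      _ ≤ |g n x - f x| + |f x| := abs_add_le _ _
      _ ≤ 3 * Bf := by linarith
  have hdg_bd : ∀ n x (k : Fin N), |fderiv ℝ (g n) x (EuclideanSpace.single k 1)| ≤ 3 * Bd := by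
    intro n x k
    rw [hdg_apply]
    have h : dist (((ρ n).normed volume ⋆[ContinuousLinearMap.lsmul ℝ ℝ, volume] fun a =>
        fderiv ℝ f a (EuclideanSpace.single k 1)) x) (fderiv ℝ f x (EuclideanSpace.single k 1)) ≤
        2 * Bd := by
      refine (ρ n).dist_normed_convolution_le (hdfv _).aestronglyMeasurable fun y _ => ?_
      rw [Real.dist_eq]
      exact (abs_sub _ _).trans (by linarith [hdfk y k, hdfk x k])
    rw [Real.dist_eq] at h
    have hx := hdfk x k
    calc |((ρ n).normed volume ⋆[ContinuousLinearMap.lsmul ℝ ℝ, volume] fun a =>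
            fderiv ℝ f a (EuclideanSpace.single k 1)) x|
        ≤ |((ρ n).normed volume ⋆[ContinuousLinearMap.lsmul ℝ ℝ, volume] fun a =>
            fderiv ℝ f a (EuclideanSpace.single k 1)) x - fderiv ℝ f x (EuclideanSpace.single k 1)| +
          |fderiv ℝ f x (EuclideanSpace.single k 1)| := by
          have := abs_add_le (((ρ n).normed volume ⋆[ContinuousLinearMap.lsmul ℝ ℝ, volume] fun a =>
            fderiv ℝ f a (EuclideanSpace.single k 1)) x - fderiv ℝ f x (EuclideanSpace.single k 1))
            (fderiv ℝ f x (EuclideanSpace.single k 1))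
          simpa using this
      _ ≤ 3 * Bd := by linarith
  ---------------------------------------------------------------- the entropy side
  have hg2le : ∀ n x, g n x ^ 2 ≤ (3 * Bf) ^ 2 := fun n x => by
    rw [← sq_abs]; exact pow_le_pow_left₀ (abs_nonneg _) (hg_bd n x) 2
  obtain ⟨M, hM⟩ := isCompact_Icc.exists_bound_of_continuousOn
    (Real.continuous_mul_log.continuousOn (s := Icc (0 : ℝ) ((3 * Bf) ^ 2)))
  have hA : Tendsto (fun n => ∫ φ, g n φ ^ 2 * Real.log (g n φ ^ 2) ∂ν) atTop
      (𝓝 (∫ φ, f φ ^ 2 * Real.log (f φ ^ 2) ∂ν)) := by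
    refine tendsto_integral_of_dominated_convergence (fun _ => M) ?_ (integrable_const M) ?_ ?_
    · exact fun n =>
        (Real.continuous_mul_log.comp ((hgs n).continuous.pow 2)).aestronglyMeasurable
    · exact fun n => Eventually.of_forall fun φ => hM _ ⟨sq_nonneg _, hg2le n φ⟩
    · exact Eventually.of_forall fun φ =>
        (Real.continuous_mul_log.tendsto _).comp ((hg_tend φ).pow 2)
  have hmean : Tendsto (fun n => ∫ φ, g n φ ^ 2 ∂ν) atTop (𝓝 (∫ φ, f φ ^ 2 ∂ν)) := by
    refine tendsto_integral_of_dominated_convergence (fun _ => (3 * Bf) ^ 2) ?_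
      (integrable_const _) ?_ ?_
    · exact fun n => ((hgs n).continuous.pow 2).aestronglyMeasurable
    · exact fun n => Eventually.of_forall fun φ => by
        rw [Real.norm_eq_abs, abs_of_nonneg (sq_nonneg _)]; exact hg2le n φ
    · exact Eventually.of_forall fun φ => (hg_tend φ).pow 2
  have hB : Tendsto (fun n => (∫ φ, g n φ ^ 2 ∂ν) * Real.log (∫ φ, g n φ ^ 2 ∂ν)) atTop
      (𝓝 ((∫ φ, f φ ^ 2 ∂ν) * Real.log (∫ φ, f φ ^ 2 ∂ν))) :=
    (Real.continuous_mul_log.tendsto _).comp hmean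
  ---------------------------------------------------------------- the energy side
  have hQ : ∀ (h : EuclideanSpace ℝ (Fin N) → ℝ) φ,
      ⟪gradient h φ, Matrix.toEuclideanLin C0 (gradient h φ)⟫ =
        ∑ k, ∑ l, C0 k l * (fderiv ℝ h φ (EuclideanSpace.single k 1) *
          fderiv ℝ h φ (EuclideanSpace.single l 1)) := fun h φ => by
    rw [inner_toEuclideanLin_self'']
    simp only [gradient_apply_single'']
  have hdgc : ∀ n (k : Fin N), Continuous fun x => fderiv ℝ (g n) x (EuclideanSpace.single k 1) :=
    fun n k => (ContinuousLinearMap.apply ℝ ℝ (EuclideanSpace.single k 1)).continuous.comp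
      ((hgs n).continuous_fderiv (by simp))
  have hC : Tendsto (fun n => ∫ φ, ⟪gradient (g n) φ, Matrix.toEuclideanLin C0
      (gradient (g n) φ)⟫ ∂ν) atTop
      (𝓝 (∫ φ, ⟪gradient f φ, Matrix.toEuclideanLin C0 (gradient f φ)⟫ ∂ν)) := by
    simp only [hQ]
    refine tendsto_integral_of_dominated_convergence
      (fun _ => ∑ k : Fin N, ∑ l : Fin N, |C0 k l| * ((3 * Bd) * (3 * Bd))) ?_
      (integrable_const _) ?_ ?_
    · exact fun n => (continuous_finsetSum _ fun k _ => continuous_finsetSum _ fun l _ =>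
        continuous_const.mul ((hdgc n k).mul (hdgc n l))).aestronglyMeasurable
    · refine fun n => Eventually.of_forall fun φ => ?_
      rw [Real.norm_eq_abs]
      refine (Finset.abs_sum_le_sum_abs _ _).trans (Finset.sum_le_sum fun k _ =>
        (Finset.abs_sum_le_sum_abs _ _).trans (Finset.sum_le_sum fun l _ => ?_))
      rw [abs_mul, abs_mul]
      exact mul_le_mul_of_nonneg_left (mul_le_mul (hdg_bd n φ k) (hdg_bd n φ l) (abs_nonneg _)
        (by positivity)) (abs_nonneg _)
    · exact Eventually.of_forall fun φ => tendsto_finsetSum _ fun k _ =>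
        tendsto_finsetSum _ fun l _ => ((hdg_tend φ _).mul (hdg_tend φ _)).const_mul _
  ---------------------------------------------------------------- pass to the limit
  exact le_of_tendsto_of_tendsto' (hA.sub hB) (hC.const_mul (2 * I)) hstep

end Bridges

end Polchinski

end Literature.Analysis.FunctionSpaces

end
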